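import Mathlib.Data.Complex.Basic
import Literature.Computability.AlgebraicComplexity.CircuitCoeffIdeal
import Literature.RingTheory.MvPolynomial.JacobianCriterionUnibranch
import Literature.RingTheory.MvPolynomial.QuotientKerDimension
import HarnessLib

/-!
# LangWeilTransfer — crux `ShatteringExclusion` (stmt-ValiantsHypothesis-6372), line `birth` v2:
# the Jacobian (gauge-rigidity) certificate for a circuit's constant vector

Route `ValiantsHypothesis/LangWeilTransfer`, crux `ShatteringExclusion`, registered line
`Cruxes/ShatteringExclusion/Lines/birth.lean` v2, open stub `stub_fewBranches` (conjecture grade):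
the constant vector `y₀ = slotConst P` of a rewired near-optimal circuit for `per_n` lies on
polynomially many irreducible components of the complexified constants variety `V_ℂ(I)`; the v1
form `Unibranching` (EXACTLY one component) implies it (`fewBranches_of_unibranching` in the
skeleton). This file makes the strongest such certificate — `y₀` is a SMOOTH point whose component
is an explicitly parametrised subvariety (e.g. the closure of its gauge-torus orbit) — CHECKABLE in
tree currency for any explicit circuit `P` over `ℂ` computing an integer polynomial `g`:

* `map_circuitCoeffIdeal_le_ker_of_skeleton_identity` — a `B`-valued point `Y_v ↦ φ(Y_v)` of the
  skeleton identity `F(x, φ(Y)) = g` (over any commutative `ℂ`-algebra `B`) is a zero of the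
  complexified coefficient ideal: `I_ℂ ≤ ker φ`;
* `existsUnique_minimalPrimes_le_ker_of_jacobian_certificate` — **certificate**: given
  (i) `r` elements of `I_ℂ` whose gradients at `y₀` are linearly independent,
  (ii) a `ℂ`-algebra map `φ : ℂ[Y] → B` into a domain whose values satisfy the skeleton identity
  and specialise to `y₀` along some `ψ : B → ℂ`, and
  (iii) `e` polynomials with algebraically independent `φ`-values, where `r + e = 4s+1`,
  the constants variety has EXACTLY ONE irreducible component through `y₀` (namely `V(ker φ)`,
  and `y₀` is a smooth point of it): the `∃!`-clause of `Unibranching` for `P`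
  (`Literature.RingTheory.MvPolynomial.existsUnique_minimalPrimes_le_ker_aeval_of_jacobian`,
  Hartshorne I.5.1, with the dimension bound from
  `Literature.RingTheory.MvPolynomial.le_ringKrullDim_quotient_ker_of_algebraicIndependent`);
* `ncard_branches_eq_one_of_jacobian_certificate` — hence the branch count of `stub_fewBranches`
  at `y₀` is `1`.

How a disprover / kit seat uses it on an explicit circuit (e.g. Ryser/Glynn for `per_3`, an ABP
for `det_n`): `e` = dimension of the gauge-torus orbit through `y₀` (rank of its weight lattice,
dead slots included), `φ(Y_v) = t^{w_v} y₀_v` into a Laurent/function-field domain `B` with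
`ψ = (t ↦ 1)`, (iii) by a transcendence argument, (i) by exhibiting `r = 4s+1-e` coefficient
identities and the rank of their Jacobian at `y₀` (a finite linear-algebra check).

Honest framing: this is infrastructure for TESTING the line's bet on explicit circuits; it proves
nothing about near-optimal circuits for `per_n`. `stub_fewBranches`, `stub_lowDegreeConstants`,
the crux and the route stay open; VP ≠ VNP is NOT moved.
-/

noncomputable section

open MvPolynomial

-- the summit and the problem share the name `ValiantsHypothesis` (D-0017 single-conjunct layout)
set_option linter.dupNamespace false

namespace Summit.ValiantsHypothesis.ValiantsHypothesis.Theorems.LangWeilTransfer.ShatteringExclusion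

open Literature.Computability.AlgebraicComplexity
open Literature.Computability.AlgebraicComplexity.ArithCircuit

/-- **A `B`-point of the skeleton identity is a zero of the complexified coefficient ideal.** For a
circuit `P` over `ℂ`, an integer target `g`, a commutative `ℂ`-algebra `B` and a `ℂ`-algebra map
`φ : ℂ[Y_0..Y_{4s}] → B`: if substituting `φ(Y_v)` for the slot variables in the skeleton
polynomial gives the image of `g` in `B[x]`, then `I_ℂ = I·ℂ[Y] ≤ ker φ`.
[cite: Burgisser2000TCS, §5 (A3) p. 85] -/
theorem map_circuitCoeffIdeal_le_ker_of_skeleton_identity {σ : Type*} (P : ArithCircuit ℂ σ)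
    (g : MvPolynomial σ ℤ) {B : Type*} [CommRing B] [Algebra ℂ B]
    (φ : MvPolynomial (Fin (4 * P.size + 1)) ℂ →ₐ[ℂ] B)
    (hφ : MvPolynomial.aeval (Sum.elim MvPolynomial.X fun v => MvPolynomial.C (φ (MvPolynomial.X v)) :
        σ ⊕ Fin (4 * P.size + 1) → MvPolynomial σ B) (skeleton P).eval =
      MvPolynomial.map (Int.castRingHom B) g) :
    (circuitCoeffIdeal P g).map (MvPolynomial.map (algebraMap ℚ ℂ)) ≤ RingHom.ker φ := by
  have hzero := (forall_aeval_circuitCoeffPoly_eq_zero_iff P g (fun v => φ (MvPolynomial.X v))).2 hφ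
  -- `φ ∘ (ℤ[Y] → ℂ[Y])` is evaluation at the `B`-point `φ(Y)`
  have hcomp : (φ : MvPolynomial (Fin (4 * P.size + 1)) ℂ →+* B).comp
      (MvPolynomial.map (Int.castRingHom ℂ)) =
        (MvPolynomial.aeval (fun v => φ (MvPolynomial.X v)) :
          MvPolynomial (Fin (4 * P.size + 1)) ℤ →ₐ[ℤ] B) := by
    refine MvPolynomial.ringHom_ext (fun n => by simp) (fun v => ?_)
    rw [RingHom.comp_apply, MvPolynomial.map_X, AlgHom.coe_toRingHom, RingHom.coe_coe,
      MvPolynomial.aeval_X]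
  rw [circuitCoeffIdeal_def, Ideal.map_span, Ideal.span_le]
  rintro _ ⟨_, ⟨α, rfl⟩, rfl⟩
  rw [SetLike.mem_coe, RingHom.mem_ker, MvPolynomial.map_map,
    show (algebraMap ℚ ℂ).comp (Int.castRingHom ℚ) = Int.castRingHom ℂ from RingHom.ext_int _ _]
  have h1 : φ (MvPolynomial.map (Int.castRingHom ℂ) (circuitCoeffPoly P g α)) =
      MvPolynomial.aeval (fun v => φ (MvPolynomial.X v)) (circuitCoeffPoly P g α) := by
    simpa using RingHom.congr_fun hcomp (circuitCoeffPoly P g α)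
  rw [h1]
  exact hzero α

/-- **The Jacobian (gauge-rigidity) certificate for a unique component through the constant
vector.** Let `P` be a circuit over `ℂ` with `s` gates, `g` an integer polynomial, `y₀ = slotConst P`,
`I_ℂ` the complexified coefficient ideal of the skeleton of `P` against `g`. Suppose
(i) `f_1, …, f_r ∈ I_ℂ` have linearly independent gradients at `y₀`;
(ii) `φ : ℂ[Y_0..Y_{4s}] → B` is a `ℂ`-algebra map into a domain whose values `φ(Y_v)` satisfy the
skeleton identity `F(x, φ(Y)) = g` and specialise to `y₀` along a `ℂ`-algebra map `ψ : B → ℂ`;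
(iii) `e` polynomials have algebraically independent `φ`-values, with `r + e = 4s + 1`.
Then exactly one minimal prime of `I_ℂ` lies below the point ideal `ker (ev_{y₀})` (it is
`ker φ`, and `y₀` is a smooth point of `V(I_ℂ)`). [cite: Hartshorne1977, Thm. I.5.1] -/
theorem existsUnique_minimalPrimes_le_ker_of_jacobian_certificate {σ : Type*}
    (P : ArithCircuit ℂ σ) (g : MvPolynomial σ ℤ) {r e : ℕ} (hre : r + e = 4 * P.size + 1)
    (f : Fin r → MvPolynomial (Fin (4 * P.size + 1)) ℂ)
    (hfI : ∀ i, f i ∈ (circuitCoeffIdeal P g).map (MvPolynomial.map (algebraMap ℚ ℂ)))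
    (hjac : LinearIndependent ℂ (fun i : Fin r => fun j : Fin (4 * P.size + 1) =>
      MvPolynomial.aeval (fun v : Fin (4 * P.size + 1) => slotConst P v)
        (MvPolynomial.pderiv j (f i))))
    {B : Type} [CommRing B] [IsDomain B] [Algebra ℂ B]
    (φ : MvPolynomial (Fin (4 * P.size + 1)) ℂ →ₐ[ℂ] B)
    (hφ : MvPolynomial.aeval (Sum.elim MvPolynomial.X fun v => MvPolynomial.C (φ (MvPolynomial.X v)) :
        σ ⊕ Fin (4 * P.size + 1) → MvPolynomial σ B) (skeleton P).eval =
      MvPolynomial.map (Int.castRingHom B) g)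
    (ψ : B →ₐ[ℂ] ℂ) (hψ : ∀ v, ψ (φ (MvPolynomial.X v)) = slotConst P v)
    (q : Fin e → MvPolynomial (Fin (4 * P.size + 1)) ℂ)
    (hq : AlgebraicIndependent ℂ (fun i => φ (q i))) :
    ∃! 𝔓 : Ideal (MvPolynomial (Fin (4 * P.size + 1)) ℂ),
      𝔓 ∈ ((circuitCoeffIdeal P g).map (MvPolynomial.map (algebraMap ℚ ℂ))).minimalPrimes ∧
        𝔓 ≤ RingHom.ker (MvPolynomial.aeval (fun v : Fin (4 * P.size + 1) => slotConst P v) :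
          MvPolynomial (Fin (4 * P.size + 1)) ℂ →ₐ[ℂ] ℂ) := by
  haveI : (RingHom.ker φ).IsPrime := RingHom.ker_isPrime _
  -- `I_ℂ ≤ ker φ ≤ 𝔪_{y₀}`
  have hIP := map_circuitCoeffIdeal_le_ker_of_skeleton_identity P g φ hφ
  have hev : (MvPolynomial.aeval (fun v : Fin (4 * P.size + 1) => slotConst P v) :
      MvPolynomial (Fin (4 * P.size + 1)) ℂ →ₐ[ℂ] ℂ) = ψ.comp φ :=
    MvPolynomial.algHom_ext fun v => by rw [MvPolynomial.aeval_X, AlgHom.comp_apply, hψ]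
  have hPy : RingHom.ker φ ≤ RingHom.ker (MvPolynomial.aeval
      (fun v : Fin (4 * P.size + 1) => slotConst P v) :
        MvPolynomial (Fin (4 * P.size + 1)) ℂ →ₐ[ℂ] ℂ) := by
    intro x hx
    rw [RingHom.mem_ker] at hx ⊢
    rw [hev, AlgHom.comp_apply, hx, map_zero]
  -- dimension of `V(ker φ)` from the algebraically independent values
  have hdim := Literature.RingTheory.MvPolynomial.le_ringKrullDim_quotient_ker_of_algebraicIndependent
    φ q hq
  exact Literature.RingTheory.MvPolynomial.existsUnique_minimalPrimes_le_ker_aeval_of_jacobian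
    (fun v : Fin (4 * P.size + 1) => slotConst P v) hre hIP hPy f hfI hjac hdim

/-- Hence, under the Jacobian certificate, **the number of irreducible components of `V_ℂ(I)`
through the constant vector is exactly `1`** — the branch count of `stub_fewBranches` for this
circuit. [cite: Hartshorne1977, Thm. I.5.1] -/
theorem ncard_branches_eq_one_of_jacobian_certificate {σ : Type*}
    (P : ArithCircuit ℂ σ) (g : MvPolynomial σ ℤ) {r e : ℕ} (hre : r + e = 4 * P.size + 1)
    (f : Fin r → MvPolynomial (Fin (4 * P.size + 1)) ℂ)
    (hfI : ∀ i, f i ∈ (circuitCoeffIdeal P g).map (MvPolynomial.map (algebraMap ℚ ℂ)))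
    (hjac : LinearIndependent ℂ (fun i : Fin r => fun j : Fin (4 * P.size + 1) =>
      MvPolynomial.aeval (fun v : Fin (4 * P.size + 1) => slotConst P v)
        (MvPolynomial.pderiv j (f i))))
    {B : Type} [CommRing B] [IsDomain B] [Algebra ℂ B]
    (φ : MvPolynomial (Fin (4 * P.size + 1)) ℂ →ₐ[ℂ] B)
    (hφ : MvPolynomial.aeval (Sum.elim MvPolynomial.X fun v => MvPolynomial.C (φ (MvPolynomial.X v)) :
        σ ⊕ Fin (4 * P.size + 1) → MvPolynomial σ B) (skeleton P).eval =
      MvPolynomial.map (Int.castRingHom B) g)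
    (ψ : B →ₐ[ℂ] ℂ) (hψ : ∀ v, ψ (φ (MvPolynomial.X v)) = slotConst P v)
    (q : Fin e → MvPolynomial (Fin (4 * P.size + 1)) ℂ)
    (hq : AlgebraicIndependent ℂ (fun i => φ (q i))) :
    {𝔓 : Ideal (MvPolynomial (Fin (4 * P.size + 1)) ℂ) |
        𝔓 ∈ ((circuitCoeffIdeal P g).map (MvPolynomial.map (algebraMap ℚ ℂ))).minimalPrimes ∧
          𝔓 ≤ RingHom.ker (MvPolynomial.aeval (fun v : Fin (4 * P.size + 1) => slotConst P v) :
            MvPolynomial (Fin (4 * P.size + 1)) ℂ →ₐ[ℂ] ℂ)}.ncard = 1 := by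
  obtain ⟨𝔓, h𝔓, huniq⟩ := existsUnique_minimalPrimes_le_ker_of_jacobian_certificate P g hre f hfI
    hjac φ hφ ψ hψ q hq
  rw [Set.ncard_eq_one]
  exact ⟨𝔓, Set.eq_singleton_iff_unique_mem.2 ⟨h𝔓, fun 𝔔 h𝔔 => huniq 𝔔 h𝔔⟩⟩

end Summit.ValiantsHypothesis.ValiantsHypothesis.Theorems.LangWeilTransfer.ShatteringExclusion

end
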